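import Summits.HubbardSuperconductivity.HubbardSuperconductivity.Theorems.AnisotropyChordTransferFibre3FinXCCover
import Summits.HubbardSuperconductivity.HubbardSuperconductivity.Theorems.AnisotropyChordTransferFibre3FinXBSym

/-!
# Route `AnisotropyChord` / H0 rotor rung: FIN per-`L` combined rows N₁+C RE-CERTIFIED cells, `L = 9` (sharper `c`)

Kernel facts `xbcCellAny 9 (49/50) 20 la lb (c', bn) = true` with a larger row-`N₁` constant `c'` than in `cellsC9` on the cells whose GM₃ side condition needs it (p3 g7 REPORT 3).
Prover seat `hubbard-h0-rotor-p3` g7; helper for piece A = stmt-HubbardSuperconductivity-23918 of rung 19089 (`--supports`, helper class).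
WHAT THIS IS NOT: nothing here proves superconductivity in the Hubbard model (rotor TARGET as worded stays FALSE, g15 verdict); kernel facts /
assembly for ONE conditional reduction at one `L`.  No sorry.
-/

set_option linter.dupNamespace false
set_option autoImplicit false

namespace Summit.HubbardSuperconductivity.HubbardSuperconductivity.Theorems.AnisotropyChord.Transfer.Fibre3

namespace FinXB

set_option maxHeartbeats 4000000 in
/-- re-certified cell 137 at `L = 9` (c = (91/200 : ℚ), b = 21/20). [folklore] -/
theorem xbc9r_137 : xbcCellAny 9 (49/50 : ℚ) 20 20439240906749801 20950221929418545 ((91/200 : ℚ), (21 : ℕ)) = true := by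
  decide +kernel

set_option maxHeartbeats 4000000 in
/-- re-certified cell 143 at `L = 9` (c = (91/200 : ℚ), b = 23/20). [folklore] -/
theorem xbc9r_143 : xbcCellAny 9 (49/50 : ℚ) 20 23703253152825405 24295834481646037 ((91/200 : ℚ), (23 : ℕ)) = true := by
  decide +kernel

end FinXB

end Summit.HubbardSuperconductivity.HubbardSuperconductivity.Theorems.AnisotropyChord.Transfer.Fibre3
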